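import Summits.Ventures.CertifiedManyBodySolver.Observables.SpinStarInequality
import Summits.Ventures.CertifiedManyBodySolver.Statement
import Literature.MathematicalPhysics.QuantumLattice.InfVolFermionStateBounds
import Literature.MathematicalPhysics.QuantumLattice.InfVolFermionStateDensity
import HarnessLib

/-!
# The Anderson star inequality in the thermodynamic limit (translation-invariant fermion states)

HONEST FRAMING: first certified bounds; not a superconductivity verdict; every number certified or
labelled float.  (Speedrun `mbsolver`, seat sr-mbsolver-m3-2, gen 10.)  This file contains NO certificate
and NO number of the tables: it transports the finite-volume operator inequality
`Σ_{y∈Y} 𝐒_x·𝐒_y + ((|Y|+2)/4)·m_x ⪰ 0` (`Observables/SpinStarInequality.lean`,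
`posSemidef_fermionSpinStar`, every finite ordered site type) to infinite-volume states
`ω : InfVolFermionState d` (§1), and for TRANSLATION-INVARIANT `ω` rewrites it in terms of the spin
correlation function `C_ω(v) = Re ω_{{0,v}}(𝐒_0·𝐒_v)` (written out; no new definition), the density `ρ(ω)` and the double occupancy
`𝒟(ω) = Re ω(n_{0↑}n_{0↓})` (§2):

* `sum_corr_ge`: `Σ_{v∈R} C_ω(v) ≥ -((|R|+2)/4)·(ρ - 2𝒟)` for every finite `R ∌ 0`;
* `corr_ge`: `C_ω(v) ≥ -(1/2)(ρ - 2𝒟)` for every `v ≠ 0` (two antipodal arms, `C_ω(-v) = C_ω(v)`);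
* `half_add_corr_ge`: `(C_ω(a) + C_ω(b))/2 ≥ -(3/8)(ρ - 2𝒟)` for `a, b ≠ 0`, `a ≠ ±b` (four arms).

These HALVE the pairwise kinematic floor `-(3/4)·Re ω(m)` (`Rows/HalfFilledTLKinematic.lean`) using
translation invariance alone (no point group, no energy input).  The M3′ rows derived from them are in
`Rows/DopedTLSpinStar.lean`.
-/

noncomputable section

namespace Summit.Ventures.CertifiedManyBodySolver

open Matrix Literature.MathematicalPhysics.QuantumLattice Literature.Probability.LatticeModels
open Literature.MathematicalPhysics.QuantumLattice.HubbardWave0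
open Literature.MathematicalPhysics.QuantumLattice.FermionSpinMoment
open ThermodynamicLimit Filter Topology
open scoped BigOperators ComplexOrder

namespace SpinStarTL

/-! ## §1 Every infinite-volume state: the star inequality in expectation -/

section AnyState

variable {d : ℕ} (ω : InfVolFermionState d)

/-- **The star inequality in a state**: for every infinite-volume state `ω`, region `Λ`, centre `x`
and finite set `Y ∌ x` of ordered sites of `Λ`,
`-((|Y|+2)/4)·Re ω_Λ(m_x) ≤ Σ_{y∈Y} Re ω_Λ(𝐒_x·𝐒_y)` (state positivity on
`Σ_{y∈Y} 𝐒_x·𝐒_y + ((|Y|+2)/4) m_x ⪰ 0`, `Observables.SpinStar.posSemidef_fermionSpinStar`).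
[cite: BratteliRobinsonI1987, Def. 2.3.9] -/
theorem sum_re_expect_fermionSpinDot_ge (Λ : Finset (Site d)) {x : PolySite Λ}
    {Y : Finset (PolySite Λ)} (hx : x ∉ Y) :
    -((((Y.card : ℝ) + 2) / 4) * (ω.expect Λ (localMoment x)).re) ≤
      ∑ y ∈ Y, (ω.expect Λ (fermionSpinDot x y)).re := by
  have h := ω.expect_re_nonneg_of_posSemidef Λ (Observables.SpinStar.posSemidef_fermionSpinStar hx)
  rw [map_add, map_sum, map_smul, Complex.add_re, Complex.re_sum, smul_eq_mul,
    show ((Y.card : ℂ) + 2) / 4 = ((((Y.card : ℝ) + 2) / 4 : ℝ) : ℂ) by push_cast; ring,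
    Complex.re_ofReal_mul] at h
  linarith

/-- The double occupancy `n_{x↑}n_{x↓} ⪰ 0` (a projection). [cite: EsslerEtAl2005, §2.2.5 eq. (2.76)] -/
theorem posSemidef_nAt_mul_nAt {Λ : Finset (Site d)} (x : Site d) (hx : x ∈ Λ) :
    (nAt x hx 0 * nAt x hx 1).PosSemidef := by
  rw [nAt, nAt, LiebThm1.numberOp_eq_diagonal, LiebThm1.numberOp_eq_diagonal, diagonal_mul_diagonal,
    posSemidef_diagonal_iff]
  intro s
  split_ifs <;> norm_num

/-- `0 ≤ Re ω(n_{0↑}n_{0↓})` for every state. [cite: BratteliRobinsonI1987, Def. 2.3.9] -/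
theorem re_expect_doccAt0_nonneg : 0 ≤ (ω.expect {0} (doccAt0 d)).re :=
  ω.expect_re_nonneg_of_posSemidef {0} (posSemidef_nAt_mul_nAt 0 _)

/-- Isotony: the local moment `m_x` of `𝔄_Λ` is read in `𝔄_{{x}}` as `n_x - 2 n_{x↑}n_{x↓}`.
[cite: ArakiMoriya2003, §4.1 Def. 4.1 (2)] -/
theorem expect_localMoment_pt_eq {Λ : Finset (Site d)} (x : Site d) (hx : x ∈ Λ) :
    ω.expect Λ (localMoment (PolySite.pt x hx)) =
      ω.expect {x} (nAt x (Finset.mem_singleton_self x) 0 + nAt x (Finset.mem_singleton_self x) 1) -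
        2 * ω.expect {x} (nAt x (Finset.mem_singleton_self x) 0 * nAt x (Finset.mem_singleton_self x) 1) := by
  have hsub : ({x} : Finset (Site d)) ⊆ Λ := Finset.singleton_subset_iff.2 hx
  rw [← ω.compatible hsub, ← ω.compatible hsub (nAt _ _ 0 * nAt _ _ 1), ← smul_eq_mul, ← map_smul,
    ← map_sub]
  congr 1
  simp only [localMoment, map_add, map_mul, fermionEmbed_numberOp, PolySite.incl_pt]

/-- Isotony: `𝐒_x·𝐒_y ∈ 𝔄_Λ` is read in `𝔄_{{x,y}}`. [cite: ArakiMoriya2003, §4.1 Def. 4.1 (2)] -/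
theorem expect_spinDotAt_eq_pair {Λ : Finset (Site d)} (x y : Site d) (hx : x ∈ Λ) (hy : y ∈ Λ) :
    ω.expect Λ (spinDotAt x hx y hy) =
      ω.expect {x, y} (spinDotAt x (Finset.mem_insert_self x {y}) y
        (Finset.mem_insert_of_mem (Finset.mem_singleton_self y))) := by
  have hsub : ({x, y} : Finset (Site d)) ⊆ Λ :=
    Finset.insert_subset hx (Finset.singleton_subset_iff.2 hy)
  rw [← ω.compatible hsub, fermionEmbed_incl_spinDotAt]

end AnyState

/-! ## §2 Translation-invariant states: `Re ω(m_x) = ρ - 2𝒟` and the shell inequalities -/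

section TI

variable {d : ℕ} {ω : InfVolFermionState d}

/-- `pt (0 + x) = pt x` (transport of the membership proof). [folklore] -/
private theorem pt_zero_add_eq {Λ : Finset (Site d)} {x : Site d} (h : 0 + x ∈ Λ) (h' : x ∈ Λ) :
    (PolySite.pt (0 + x) h : PolySite Λ) = PolySite.pt x h' :=
  Subtype.ext (congrArg toLex (zero_add x))

/-- `shiftSet x {0} ⊆ {x}`. [folklore] -/
private theorem shiftSet_singleton_zero_subset (x : Site d) :
    shiftSet x ({0} : Finset (Site d)) ⊆ {x} := by
  intro z hz
  rw [mem_shiftSet, Finset.mem_singleton, sub_eq_zero] at hz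
  rw [Finset.mem_singleton, hz]

/-- For translation-invariant `ω`: `ω(n_{x↑}n_{x↓}) = ω(n_{0↑}n_{0↓})`. [cite: ArakiMoriya2003, §4.1 Def. 4.5] -/
theorem expect_nAt_mul_nAt_eq (hω : ω.IsTranslationInvariant) (x : Site d) :
    ω.expect {x} (nAt x (Finset.mem_singleton_self x) 0 * nAt x (Finset.mem_singleton_self x) 1) =
      ω.expect {0} (doccAt0 d) := by
  conv_rhs => rw [← hω x, InfVolFermionState.shift_expect]
  refine ω.expect_fermionEmbed_incl_eq (subset_refl {x})
    (shiftSet_singleton_zero_subset x) _ _ ?_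
  simp only [doccAt0, map_mul, fermionEmbed_numberOp, PolySite.shiftEmb_pt, PolySite.incl_pt]
  rw [pt_zero_add_eq _ (Finset.mem_singleton_self x)]

/-- For translation-invariant `ω`: `Re ω(n_{x↑} + n_{x↓}) = ρ(ω)`. [cite: ArakiMoriya2003, §4.1 Def. 4.5] -/
theorem re_expect_nAt_add_nAt_eq_density (hω : ω.IsTranslationInvariant) (x : Site d) :
    (ω.expect {x} (nAt x (Finset.mem_singleton_self x) 0 + nAt x (Finset.mem_singleton_self x) 1)).re =
      ω.density := by
  have h : ω.expect {x} (nAt x (Finset.mem_singleton_self x) 0 + nAt x (Finset.mem_singleton_self x) 1) =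
      ω.expect {0} (nAt 0 (Finset.mem_singleton_self 0) 0 + nAt 0 (Finset.mem_singleton_self 0) 1) := by
    conv_rhs => rw [← hω x, InfVolFermionState.shift_expect]
    refine ω.expect_fermionEmbed_incl_eq (subset_refl {x})
      (shiftSet_singleton_zero_subset x) _ _ ?_
    simp only [map_add, fermionEmbed_numberOp, PolySite.shiftEmb_pt, PolySite.incl_pt]
    rw [pt_zero_add_eq _ (Finset.mem_singleton_self x)]
  rw [h, InfVolFermionState.density, InfVolFermionState.densityAt]

/-- **`Re ω_Λ(m_x) = ρ(ω) - 2 Re ω(n_{0↑}n_{0↓})`** for translation-invariant `ω` and every region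
`Λ ∋ x`. [cite: EsslerEtAl2005, §2.2.5 eq. (2.76)] -/
theorem re_expect_localMoment_eq (hω : ω.IsTranslationInvariant) {Λ : Finset (Site d)} (x : Site d)
    (hx : x ∈ Λ) :
    (ω.expect Λ (localMoment (PolySite.pt x hx))).re =
      ω.density - 2 * (ω.expect {0} (doccAt0 d)).re := by
  rw [expect_localMoment_pt_eq, Complex.sub_re, re_expect_nAt_add_nAt_eq_density hω,
    expect_nAt_mul_nAt_eq hω, show (2 : ℂ) = ((2 : ℝ) : ℂ) by norm_num, Complex.re_ofReal_mul]

/-- `shiftSet x {0, y - x} ⊆ {x, y}`. [folklore] -/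
private theorem shiftSet_pair_subset (x y : Site d) :
    shiftSet x ({0, y - x} : Finset (Site d)) ⊆ {x, y} := by
  intro z hz
  rw [mem_shiftSet, Finset.mem_insert, Finset.mem_singleton] at hz
  rw [Finset.mem_insert, Finset.mem_singleton]
  rcases hz with h | h
  · exact Or.inl (sub_eq_zero.1 h)
  · exact Or.inr (sub_left_injective h)

/-- **Translation invariance of the spin correlator**: for translation-invariant `ω`, every region
`Λ ∋ x, y`: `Re ω_Λ(𝐒_x·𝐒_y) = C_ω(y - x)`. [cite: ArakiMoriya2003, §4.1 Def. 4.5] -/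
theorem re_expect_spinDotAt_eq_corr (hω : ω.IsTranslationInvariant) {Λ : Finset (Site d)}
    (x y : Site d) (hx : x ∈ Λ) (hy : y ∈ Λ) :
    (ω.expect Λ (spinDotAt x hx y hy)).re =
      (ω.expect {0, y - x} (spinDotAt 0 (Finset.mem_insert_self 0 {y - x}) (y - x)
        (Finset.mem_insert_of_mem (Finset.mem_singleton_self (y - x))))).re := by
  rw [expect_spinDotAt_eq_pair]
  congr 1
  conv_rhs => rw [← hω x, InfVolFermionState.shift_expect, fermionEmbed_shiftEmb_spinDotAt]
  refine ω.expect_fermionEmbed_incl_eq (subset_refl _) (shiftSet_pair_subset x y) _ _ ?_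
  rw [fermionEmbed_incl_spinDotAt, fermionEmbed_incl_spinDotAt]
  have h1 : ∀ (h : 0 + x ∈ ({x, y} : Finset (Site d))) (h' : x ∈ ({x, y} : Finset (Site d))),
      (PolySite.pt (0 + x) h : PolySite ({x, y} : Finset (Site d))) = PolySite.pt x h' :=
    fun h h' => Subtype.ext (congrArg toLex (zero_add x))
  have h2 : ∀ (h : y - x + x ∈ ({x, y} : Finset (Site d))) (h' : y ∈ ({x, y} : Finset (Site d))),
      (PolySite.pt (y - x + x) h : PolySite ({x, y} : Finset (Site d))) = PolySite.pt y h' :=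
    fun h h' => Subtype.ext (congrArg toLex (sub_add_cancel y x))
  simp only [spinDotAt, h1 _ (Finset.mem_insert_self x {y}),
    h2 _ (Finset.mem_insert_of_mem (Finset.mem_singleton_self y))]

/-- The same for ordered sites `x, y : PolySite Λ`. [cite: ArakiMoriya2003, §4.1 Def. 4.5] -/
theorem re_expect_fermionSpinDot_eq_corr (hω : ω.IsTranslationInvariant) {Λ : Finset (Site d)}
    (x y : PolySite Λ) :
    (ω.expect Λ (fermionSpinDot x y)).re =
      (ω.expect {0, ofLex y.1 - ofLex x.1} (spinDotAt 0 (Finset.mem_insert_self 0 {ofLex y.1 - ofLex x.1}) (ofLex y.1 - ofLex x.1)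
        (Finset.mem_insert_of_mem (Finset.mem_singleton_self (ofLex y.1 - ofLex x.1))))).re := by
  rw [← re_expect_spinDotAt_eq_corr hω (ofLex x.1) (ofLex y.1) (PolySite.ofLex_mem x)
    (PolySite.ofLex_mem y)]
  rfl

/-- **`C_ω(-v) = C_ω(v)`** for translation-invariant `ω` (`𝐒_0·𝐒_{-v} = 𝐒_{-v}·𝐒_0`, then translate
by `v`). [cite: ArakiMoriya2003, §4.1 Def. 4.5] -/
theorem corr_neg (hω : ω.IsTranslationInvariant) (v : Site d) :
    (ω.expect {0, -v} (spinDotAt 0 (Finset.mem_insert_self 0 {-v}) (-v)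
        (Finset.mem_insert_of_mem (Finset.mem_singleton_self (-v))))).re =
      (ω.expect {0, v} (spinDotAt 0 (Finset.mem_insert_self 0 {v}) (v)
        (Finset.mem_insert_of_mem (Finset.mem_singleton_self (v))))).re := by
  have h := re_expect_spinDotAt_eq_corr hω (Λ := ({0, -v} : Finset (Site d))) (-v) 0
    (Finset.mem_insert_of_mem (Finset.mem_singleton_self _)) (Finset.mem_insert_self _ _)
  rw [sub_neg_eq_add, zero_add] at h
  rw [← h, spinDotAt, spinDotAt, fermionSpinDot_comm]

/-- Transport of the two-point function along an equality of displacements. [folklore] -/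
theorem corr_congr (ω : InfVolFermionState d) {v w : Site d} (h : v = w) :
    (ω.expect {0, v} (spinDotAt 0 (Finset.mem_insert_self 0 {v}) (v)
        (Finset.mem_insert_of_mem (Finset.mem_singleton_self (v))))).re =
      (ω.expect {0, w} (spinDotAt 0 (Finset.mem_insert_self 0 {w}) (w)
        (Finset.mem_insert_of_mem (Finset.mem_singleton_self (w))))).re := by
  subst h; rfl

/-- `pt` is injective on sites. [folklore] -/
private theorem pt_injective {Λ : Finset (Site d)} {x y : Site d} {hx : x ∈ Λ} {hy : y ∈ Λ}
    (h : PolySite.pt x hx = PolySite.pt y hy) : x = y := by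
  simpa using congrArg (fun p : PolySite Λ => ofLex p.1) h

/-- **The shell inequality**: for translation-invariant `ω` and every finite set `R` of NONZERO
displacements, `Σ_{v∈R} C_ω(v) ≥ -((|R|+2)/4)(ρ(ω) - 2 Re ω(n_{0↑}n_{0↓}))` (the star inequality at
centre `0` on the region `{0} ∪ R`, translation invariance for `m_0`). [cite: Tasaki2020, App. A.3] -/
theorem sum_corr_ge (hω : ω.IsTranslationInvariant) {R : Finset (Site d)} (h0 : (0 : Site d) ∉ R) :
    -((((R.card : ℝ) + 2) / 4) * (ω.density - 2 * (ω.expect {0} (doccAt0 d)).re)) ≤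
      ∑ v ∈ R, (ω.expect {0, v} (spinDotAt 0 (Finset.mem_insert_self 0 {v}) (v)
        (Finset.mem_insert_of_mem (Finset.mem_singleton_self (v))))).re := by
  have h0Λ : (0 : Site d) ∈ insert (0 : Site d) R := Finset.mem_insert_self 0 R
  have hRΛ : ∀ v ∈ R, v ∈ insert (0 : Site d) R := fun v hv => Finset.mem_insert_of_mem hv
  let e : {v // v ∈ R} ↪ PolySite (insert (0 : Site d) R) :=
    ⟨fun v => PolySite.pt v.1 (hRΛ v.1 v.2), fun v w h => Subtype.ext (pt_injective h)⟩
  have hx : PolySite.pt 0 h0Λ ∉ R.attach.map e := by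
    simp only [Finset.mem_map, Finset.mem_attach, true_and, not_exists]
    rintro ⟨v, hv⟩ h
    have h' : PolySite.pt v (hRΛ v hv) = PolySite.pt 0 h0Λ := h
    exact h0 ((pt_injective h') ▸ hv)
  have h := sum_re_expect_fermionSpinDot_ge ω (insert (0 : Site d) R) hx
  rw [Finset.card_map, Finset.card_attach, Finset.sum_map, re_expect_localMoment_eq hω] at h
  refine h.trans (le_of_eq ?_)
  rw [← Finset.sum_attach R]
  refine Finset.sum_congr rfl fun v _ => ?_
  rw [re_expect_fermionSpinDot_eq_corr hω (PolySite.pt 0 h0Λ) (e v)]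
  exact corr_congr ω (sub_zero v.1)

/-- `a ≠ -a` for a nonzero site of `ℤ^d`. [folklore] -/
private theorem ne_neg_of_ne_zero {a : Site d} (ha : a ≠ 0) : a ≠ -a := by
  intro h
  refine ha (funext fun i => ?_)
  have hi := congrFun h i
  simp only [Pi.neg_apply] at hi
  simp only [Pi.zero_apply]
  omega

/-- **Single displacement**: `C_ω(v) ≥ -(1/2)(ρ - 2 Re ω(n_{0↑}n_{0↓}))` for `v ≠ 0` and
translation-invariant `ω` (the two-arm star `R = {v, -v}` and `C_ω(-v) = C_ω(v)`): HALF the pairwise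
floor `-(3/4)·Re ω(m)`. [cite: Tasaki2020, App. A.3] -/
theorem corr_ge (hω : ω.IsTranslationInvariant) {v : Site d} (hv : v ≠ 0) :
    -((1 / 2) * (ω.density - 2 * (ω.expect {0} (doccAt0 d)).re)) ≤
      (ω.expect {0, v} (spinDotAt 0 (Finset.mem_insert_self 0 {v}) (v)
        (Finset.mem_insert_of_mem (Finset.mem_singleton_self (v))))).re := by
  have hvv : v ≠ -v := ne_neg_of_ne_zero hv
  have h0 : (0 : Site d) ∉ ({v, -v} : Finset (Site d)) := by
    simp only [Finset.mem_insert, Finset.mem_singleton, not_or]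
    exact ⟨hv.symm, fun h => hv (neg_eq_zero.1 h.symm)⟩
  have h := sum_corr_ge hω h0
  rw [Finset.card_pair hvv, Finset.sum_pair hvv, corr_neg hω v] at h
  push_cast at h
  linarith

/-- **Orthogonal pair of displacements**: for `a, b ≠ 0` with `a ≠ ±b` and translation-invariant `ω`,
`(1/2)(C_ω(a) + C_ω(b)) ≥ -(3/8)(ρ - 2 Re ω(n_{0↑}n_{0↓}))` (the four-arm star `R = {a, b, -a, -b}`
and `C_ω(-v) = C_ω(v)`): HALF the pairwise floor. NN shell: `a = e₁, b = e₂`; NNN shell: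
`a = e₁ + e₂, b = e₂ - e₁`. [cite: Tasaki2020, App. A.3] -/
theorem half_add_corr_ge (hω : ω.IsTranslationInvariant) {a b : Site d} (ha : a ≠ 0) (hb : b ≠ 0)
    (hab : a ≠ b) (hab' : a ≠ -b) :
    -((3 / 8) * (ω.density - 2 * (ω.expect {0} (doccAt0 d)).re)) ≤
      (1 / 2) * ((ω.expect {0, a} (spinDotAt 0 (Finset.mem_insert_self 0 {a}) (a)
        (Finset.mem_insert_of_mem (Finset.mem_singleton_self (a))))).re +
        (ω.expect {0, b} (spinDotAt 0 (Finset.mem_insert_self 0 {b}) (b)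
        (Finset.mem_insert_of_mem (Finset.mem_singleton_self (b))))).re) := by
  have haa : a ≠ -a := ne_neg_of_ne_zero ha
  have hbb : b ≠ -b := ne_neg_of_ne_zero hb
  have hba' : b ≠ -a := fun h => hab' (by rw [h, neg_neg])
  have hab'' : -a ≠ -b := fun h => hab (neg_injective h)
  have h0 : (0 : Site d) ∉ ({a, b, -a, -b} : Finset (Site d)) := by
    simp only [Finset.mem_insert, Finset.mem_singleton, not_or]
    exact ⟨ha.symm, hb.symm, fun h => ha (neg_eq_zero.1 h.symm), fun h => hb (neg_eq_zero.1 h.symm)⟩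
  have h := sum_corr_ge hω h0
  have hc : ({a, b, -a, -b} : Finset (Site d)).card = 4 := by
    rw [Finset.card_insert_of_notMem, Finset.card_insert_of_notMem, Finset.card_pair hab'']
    · simp only [Finset.mem_insert, Finset.mem_singleton, not_or]; exact ⟨hba', hbb⟩
    · simp only [Finset.mem_insert, Finset.mem_singleton, not_or]; exact ⟨hab, haa, hab'⟩
  have hs : ∑ v ∈ ({a, b, -a, -b} : Finset (Site d)), (ω.expect {0, v} (spinDotAt 0 (Finset.mem_insert_self 0 {v}) (v)
        (Finset.mem_insert_of_mem (Finset.mem_singleton_self (v))))).re =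
      (ω.expect {0, a} (spinDotAt 0 (Finset.mem_insert_self 0 {a}) (a)
        (Finset.mem_insert_of_mem (Finset.mem_singleton_self (a))))).re +
      (ω.expect {0, b} (spinDotAt 0 (Finset.mem_insert_self 0 {b}) (b)
        (Finset.mem_insert_of_mem (Finset.mem_singleton_self (b))))).re +
      (ω.expect {0, -a} (spinDotAt 0 (Finset.mem_insert_self 0 {-a}) (-a)
        (Finset.mem_insert_of_mem (Finset.mem_singleton_self (-a))))).re +
      (ω.expect {0, -b} (spinDotAt 0 (Finset.mem_insert_self 0 {-b}) (-b)
        (Finset.mem_insert_of_mem (Finset.mem_singleton_self (-b))))).re := by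
    rw [Finset.sum_insert, Finset.sum_insert, Finset.sum_pair hab'']
    · ring
    · simp only [Finset.mem_insert, Finset.mem_singleton, not_or]; exact ⟨hba', hbb⟩
    · simp only [Finset.mem_insert, Finset.mem_singleton, not_or]; exact ⟨hab, haa, hab'⟩
  rw [hc, hs, corr_neg hω a, corr_neg hω b] at h
  push_cast at h
  linarith

/-- The pair inequality for two arms `𝐒_x·𝐒_p`, `𝐒_x·𝐒_q` of one region (ordered sites; the form met by
the `D₄`-images of a two-arm word). [cite: Tasaki2020, App. A.3] -/
theorem half_add_re_expect_fermionSpinDot_ge (hω : ω.IsTranslationInvariant) {Λ : Finset (Site d)}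
    (x p q : PolySite Λ) (hp : ofLex p.1 - ofLex x.1 ≠ 0) (hq : ofLex q.1 - ofLex x.1 ≠ 0)
    (hpq : ofLex p.1 - ofLex x.1 ≠ ofLex q.1 - ofLex x.1)
    (hpq' : ofLex p.1 - ofLex x.1 ≠ -(ofLex q.1 - ofLex x.1)) :
    -((3 / 8) * (ω.density - 2 * (ω.expect {0} (doccAt0 d)).re)) ≤
      (1 / 2) * ((ω.expect Λ (fermionSpinDot x p)).re + (ω.expect Λ (fermionSpinDot x q)).re) := by
  rw [re_expect_fermionSpinDot_eq_corr hω x p, re_expect_fermionSpinDot_eq_corr hω x q]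
  exact half_add_corr_ge hω hp hq hpq hpq'

end TI

end SpinStarTL

end Summit.Ventures.CertifiedManyBodySolver
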